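import Summits.CriticalPhenomena.CardyFormulaZ2.Theses.CardyIKTransport
import Summits.CriticalPhenomena.CardyFormulaZ2.Theorems.IKLinearTransport.Negative.CruxConsequences
import Literature.Probability.Percolation.CardyFormulaConformalInvariance
import Literature.Probability.RandomPlanarGeometry.ConformalRectangleProofs
import Literature.Probability.LatticeModels.TriangularLattice

/-!
# Vocabulary of the crux `CardyIKTransport.IKLinearTransport` (stmt-CriticalPhenomena-5076) and of its
# line `pinned-diagram-exchange`

Definitions-only support file (plus the definitional `crux_iff` and the sorry-free COMPOSITION
`IKLinearTransport_of_stubs`), so that the line's REGISTERED STUBS — landed one by one as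
`--supports stmt-CriticalPhenomena-5076` files under `Theorems/` — and the lead's skeleton
(`Cruxes/IKLinearTransport/Lines/pinned-diagram-exchange.lean`, not importable) speak about the SAME
declarations. Every definition below is byte-identical in body to the planner's checked skeleton
(crux-plan 2026-08-16, sha `db054dbad1c7`; triage r1-1 pass); nothing is asserted here except the two
definitional rewritings `mixedCrossingProb_univ` / `crux_iff` and the composition theorem, whose
hypotheses are the six registered stub signatures. These are statements the ROUTE POSITS (the line's
sub-goals), not literature facts: they live here, parametrised, and are never to be relocated.

THE MODEL. The explicit i.i.d.-bit gauge shared by routes CardyIKTransport / CardyDiluteOrbit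
(stmt-5911): `Ω` = row signs × column signs × biased plaquettes × fair plaquettes × diagonal coins,
`μIK` their product law; `S ⊆ ℤ` is the set of ISOTROPIC face columns (corner fugacity `t = √3/2`,
fair diagonal coin), the other face columns are HONEYCOMB (`t = 1`, anti-diagonal forced); `S = univ`
is the crux's `P_IK` (`crux_iff`) and `S = ∅` is site percolation on `𝕋` drawn on the square grid.
THE STUB PREDICATES (all parametrised; the registered stub signatures quantify them — lead's reshape
v2 of 2026-08-16, names of the stubs unchanged): `DiagramExchangeAt L` (finite pinned Yang–Baxter
identity on the cylinder `ℤ/L`), `IsExchangeKernel C c S i T` (infinite-volume exchange maps, Fact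
5.15 of arXiv:2502.08394 for IK), `CondRSWBound c S n a b E` (Manolescu's (RSW), Thm 5.7, conditional
form), `IsTransportCoupling K₁` (Thm 5.4 re-run, §5.3), `TransportsWithin K₁`, `IsTriShear K₀`,
`CrudeCardyAlong K₀ S` (the `S = ∅` member is Smirnov's model after the shear `K₀`).

References: I. Manolescu, arXiv:2502.08394, Thm 5.4, Fact 5.15, Thm 5.7, §5.3; A. Morin-Duchesne,
A. Klümper, P. Pearce, arXiv:2211.12379 §2.2, §3.6 (dilute `A₂⁽²⁾` at `λ = π/3`: `u = π/3` is site-𝕋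
with one diagonal, `u = π/2` isotropic); the route file `Theses/CardyIKTransport.lean` (item 5076); the
line card `Cruxes/IKLinearTransport/Lines/pinned-diagram-exchange.md`.
-/

noncomputable section

namespace Summit.CriticalPhenomena.CardyFormulaZ2.Theorems.IKLinearTransport.PinnedDiagramExchange

open scoped BigOperators Topology Classical MeasureTheory ProbabilityTheory ENNReal
open Filter Set Function MeasureTheory
open Literature.Probability.Percolation Literature.Probability.LatticeModels
open Literature.Probability.RandomPlanarGeometry

/-! ## §1 The column-mixed Izergin–Korepin gauge -/

/-- The bit space of the explicit gauge: row signs × column signs × biased plaquettes × fair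
plaquettes × diagonal coins. [folklore] -/
abbrev Ω : Type := Set ℤ × (Set ℤ × (Set (Site 2) × (Set (Site 2) × Set (Site 2))))

/-- The gauge measure (it does not depend on the column pattern `S`). [folklore] -/
def μIK : Measure Ω :=
  (sitePercolation ℤ half).prod ((sitePercolation ℤ half).prod
    ((sitePercolation (Site 2) (Set.projIcc (0:ℝ) 1 zero_le_one (2 * Real.sqrt 3 - 3))).prod
      ((sitePercolation (Site 2) half).prod (sitePercolation (Site 2) half))))

/-- Plaquette-parity set: the face with lower-left cell `f` reads the biased field on `S`-columns and
the fair field elsewhere. [folklore] -/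
def parSet (S : Set ℤ) (ω : Ω) : Set (Site 2) :=
  {f | (f 0 ∈ S ∧ f ∈ ω.2.2.1) ∨ (f 0 ∉ S ∧ f ∈ ω.2.2.2.1)}

/-- Black cells: row sign ⊕ column sign ⊕ parity of the plaquettes in the rectangle from `0` to `v`. [folklore] -/
def blackSet (S : Set ℤ) (ω : Ω) : Set (Site 2) :=
  {v | Xor (v 0 ∈ ω.1) (Xor (v 1 ∈ ω.2.1) (Odd ((Finset.filter (fun f : ℤ × ℤ => ![f.1, f.2] ∈ parSet S ω)
    (Finset.Ico (min 0 (v 0)) (max 0 (v 0)) ×ˢ Finset.Ico (min 0 (v 1)) (max 0 (v 1)))).card)))}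

/-- Faces carrying the ANTI-diagonal: forced off `S`, a fair coin on `S`. [folklore] -/
def antiSet (S : Set ℤ) (ω : Ω) : Set (Site 2) := {f | f 0 ∉ S ∨ f ∈ ω.2.2.2.2}

/-- Observable configurations: (black cells, anti-diagonal faces). [folklore] -/
abbrev Obs : Type := Set (Site 2) × Set (Site 2)

/-- The observable configuration of the `S`-mixed model. [folklore] -/
def obs (S : Set ℤ) (ω : Ω) : Obs := (blackSet S ω, antiSet S ω)

/-- Law of the observables of the `S`-mixed model (push-forward of `μIK` by `obs S`). [folklore] -/
def νmix (S : Set ℤ) : Measure Obs := μIK.map (obs S)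

/-- The random triangulation of `ℤ²` read from an anti-diagonal set `A`: nearest neighbours, the main
diagonal `u — u+(1,1)` of the face `u` when `u ∉ A`, the anti-diagonal `u+(0,1) — u+(1,0)` when `u ∈ A`
(written from its upper-left corner: `u — u+(1,-1)` iff `u+(0,-1) ∈ A`). [folklore] -/
def cellGraph (A : Set (Site 2)) : SimpleGraph (Site 2) :=
  SimpleGraph.fromRel fun u v =>
    v = u + ![1, 0] ∨ v = u + ![0, 1] ∨ (v = u + ![1, 1] ∧ u ∉ A) ∨ (v = u + ![1, -1] ∧ (u + ![0, -1]) ∈ A)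

/-- Open edges: edges of the triangulation between two black cells (literally the crux's `edges`). [folklore] -/
def blackEdges (x : Obs) : BondConfig (Site 2) :=
  {e | ∃ u v, e = s(u, v) ∧ u ∈ x.1 ∧ v ∈ x.1 ∧
    (v = u + ![1, 0] ∨ v = u + ![0, 1] ∨ (v = u + ![1, 1] ∧ ¬ u ∈ x.2) ∨ (v = u + ![1, -1] ∧ (u + ![0, -1]) ∈ x.2))}

/-- The square embedding of the cells. [folklore] -/
def sqEmb : Site 2 → ℂ := fun v => ((v 0 : ℝ) : ℂ) + ((v 1 : ℝ) : ℂ) * Complex.I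

/-- Crude crossing probability of the conformal rectangle `R` at mesh `δ` for the `S`-mixed model
(`S = univ`: the crux's `P_IK`; `S = ∅`: site percolation on `𝕋` drawn on the square grid). [folklore] -/
def mixedCrossingProb (S : Set ℤ) (R : ConformalRectangle) (δ : ℝ) : ℝ :=
  μIK.real {ω | blackEdges (obs S ω) ∈ embDomainCrossing sqEmb R.carrier δ (R.arc 0) (R.arc 2)}

/-- The monochromatic cluster of the cell `a` in the observable configuration `x`: cells of the colour
of `a` joined to `a` by a path of `cellGraph x.2` through cells of that colour. [folklore] -/
def monoCluster (x : Obs) (a : Site 2) : Set (Site 2) :=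
  {b | ∃ h : (b ∈ x.1 ↔ a ∈ x.1),
    ((cellGraph x.2).induce {v | v ∈ x.1 ↔ a ∈ x.1}).Reachable ⟨a, Iff.rfl⟩ ⟨b, h⟩}

/-- Events of observables determined by the cells/faces in `Λ`. [folklore] -/
def determinedOn (Λ : Set (Site 2)) : Set (Set Obs) :=
  {E | ∀ x y : Obs, (∀ v ∈ Λ, (v ∈ x.1 ↔ v ∈ y.1) ∧ (v ∈ x.2 ↔ v ∈ y.2)) → (x ∈ E ↔ y ∈ E)}

/-- Sup-norm ball of radius `r` around the cell `v`. [folklore] -/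
def ballInf (v : Site 2) (r : ℕ) : Set (Site 2) := {w | |w 0 - v 0| ≤ r ∧ |w 1 - v 1| ≤ r}

/-- Vertical shift of an observable configuration by `m` rows. [folklore] -/
def vshift (m : ℤ) (x : Obs) : Obs := ((fun v => v - ![0, m]) ⁻¹' x.1, (fun v => v - ![0, m]) ⁻¹' x.2)

/-! ## §2 Stub statement 1 — the finite pinned Yang–Baxter identity on cylinders -/

/-- The three-column cylinder block `Fin 3 × ℤ/L` with anti-diagonal flags `a` on its faces
`Fin 2 × ℤ/L` (face `(j,r)` has corners `(j,r), (j+1,r), (j,r+1), (j+1,r+1)`): vertical and horizontal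
nearest neighbours, the main diagonal `(j,r) — (j+1,r+1)` when `a (j,r) = false`, the anti-diagonal
`(j,r+1) — (j+1,r)` when `a (j,r) = true`. [folklore] -/
def blockGraph (L : ℕ) (a : Fin 2 × ZMod L → Bool) : SimpleGraph (Fin 3 × ZMod L) :=
  SimpleGraph.fromRel fun x y =>
    (y.1 = x.1 ∧ y.2 = x.2 + 1) ∨ (y.1.val = x.1.val + 1 ∧ y.2 = x.2) ∨
    (∃ j : Fin 2, x.1 = j.castSucc ∧ y.1 = j.succ ∧ y.2 = x.2 + 1 ∧ a (j, x.2) = false) ∨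
    (∃ j : Fin 2, x.1 = j.castSucc ∧ y.1 = j.succ ∧ x.2 = y.2 + 1 ∧ a (j, y.2) = true)

/-- Monochromatic cluster of `x` inside the block (colouring `col`, flags `a`). [folklore] -/
def blockCluster (L : ℕ) (col : Fin 3 × ZMod L → Bool) (a : Fin 2 × ZMod L → Bool)
    (x : Fin 3 × ZMod L) : Set (Fin 3 × ZMod L) :=
  {y | ∃ h : col y = col x, ((blockGraph L a).induce {z | col z = col x}).Reachable ⟨x, rfl⟩ ⟨y, h⟩}

/-- The connectivity DIAGRAM the block induces on its `2L` boundary cells (side `0` = column `0`,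
side `1` = column `2`): pairs joined by a monochromatic path inside the block. [folklore] -/
def blockDiagram (L : ℕ) (col : Fin 3 × ZMod L → Bool) (a : Fin 2 × ZMod L → Bool) :
    Set ((Fin 2 × ZMod L) × (Fin 2 × ZMod L)) :=
  {pq | ((![0, 2] : Fin 2 → Fin 3) pq.2.1, pq.2.2) ∈
    blockCluster L col a ((![0, 2] : Fin 2 → Fin 3) pq.1.1, pq.1.2)}

/-- Parity of a face: odd number of black corners. [folklore] -/
def faceOdd (L : ℕ) (col : Fin 3 × ZMod L → Bool) (f : Fin 2 × ZMod L) : Bool :=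
  (col (f.1.castSucc, f.2) ^^ col (f.1.succ, f.2)) ^^ (col (f.1.castSucc, f.2 + 1) ^^ col (f.1.succ, f.2 + 1))

/-- Local face weight of the two column types at `λ = π/3`: isotropic (`u = π/2`: corner fugacity
`√3/2` on odd faces, fair diagonal) and honeycomb (`u = π/3`: fugacity `1`, anti-diagonal forced —
"eight tiles of weight 1, the ninth 0", arXiv:2211.12379 §3.6). [folklore] -/
def faceWeight (iso : Bool) (odd antiFlag : Bool) : ℝ :=
  if iso then (if odd then Real.sqrt 3 / 2 else 1) / 2 else (if antiFlag then 1 else 0)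

/-- Weight of a block configuration for the column types `τ` (`τ j = true`: column `j` isotropic). [folklore] -/
def blockWeight (L : ℕ) [NeZero L] (τ : Fin 2 → Bool) (col : Fin 3 × ZMod L → Bool)
    (a : Fin 2 × ZMod L → Bool) : ℝ :=
  ∏ f : Fin 2 × ZMod L, faceWeight (τ f.1) (faceOdd L col f) (a f)

/-- Diagram-resolved ("pinned") two-column transfer weight: total weight of the interior
configurations (middle colouring `η`, flags `a`) inducing the diagram `Δ` between the boundary
colourings `ξ` (column 0) and `ζ` (column 2). [folklore] -/
def pinnedWeight (L : ℕ) [NeZero L] (τ : Fin 2 → Bool) (ξ ζ : ZMod L → Bool)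
    (Δ : Set ((Fin 2 × ZMod L) × (Fin 2 × ZMod L))) : ℝ :=
  ∑ η : ZMod L → Bool, ∑ a : Fin 2 × ZMod L → Bool,
    if blockDiagram L (fun x => (![ξ, η, ζ] : Fin 3 → ZMod L → Bool) x.1 x.2) a = Δ then
      blockWeight L τ (fun x => (![ξ, η, ζ] : Fin 3 → ZMod L → Bool) x.1 x.2) a else 0

/-- STUB STATEMENT 1 at circumference `L` · `DiagramExchangeAt L` (registered stub:
`stub_DiagramExchange : ∀ L [NeZero L], 3 ≤ L → DiagramExchangeAt L`). For every pair of boundary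
colourings and every boundary connectivity diagram, the diagram-resolved weight of the block
(honeycomb column, isotropic column) equals that of (isotropic, honeycomb). The colour-summed version
is the Yang–Baxter commutation `T(π/3)T(π/2) = T(π/2)T(π/3)` of the dilute `A₂⁽²⁾` row transfer
matrices (arXiv:2211.12379 §2.2, §3.6); the diagram-level refinement is the line's first lemma
(exact enumeration, 0 mismatches at `L = 3, …, 6`). A statement the route POSITS (not literature). [folklore] -/
def DiagramExchangeAt (L : ℕ) [NeZero L] : Prop :=
  ∀ (ξ ζ : ZMod L → Bool) (Δ : Set ((Fin 2 × ZMod L) × (Fin 2 × ZMod L))),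
    pinnedWeight L ![false, true] ξ ζ Δ = pinnedWeight L ![true, false] ξ ζ Δ

/-! ## §3 Stub statement 2 — the infinite-volume pinned exchange maps (Fact 5.15 for IK) -/

/-- Fresh local randomness for the exchange maps: i.i.d. fair bits, countably many per cell. [folklore] -/
abbrev Rnd : Type := Set (Site 2 × ℕ)

/-- Law of the fresh randomness. [folklore] -/
def β : Measure Rnd := sitePercolation (Site 2 × ℕ) half

/-- Vertical shift of the fresh randomness by `m` rows. [folklore] -/
def ushift (m : ℤ) (u : Rnd) : Rnd := {q | (q.1 - ![0, m], q.2) ∈ u}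

/-- EXCHANGE MAP predicate (Fact 5.15 of arXiv:2502.08394, p. 61, for the IK family; registered stub
`stub_PinnedExchange : (∀ L, 3 ≤ L → DiagramExchangeAt L) → ∃ C c, 0 < c ∧ ∀ S i, (i ∈ S ↔ i+1 ∉ S) →
∃ T, IsExchangeKernel C c S i T`). `T : Obs × Rnd → Obs` is an exchange map for the pattern `S` at the
adjacent face columns `i, i+1` (of different type) with locality constants `C, c`: it is measurable and
(i) transports `ν_S ⊗ β` to `ν_{S ∆ {i,i+1}}`; (ii) a.s. the colours off cell column `i+1` and the
diagonals off face columns `i, i+1` are unchanged; (iii) a.s. any two cells off column `i+1` are in the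
same monochromatic cluster after the exchange iff they were before; (iv) it is covariant under vertical
shifts; (v) quasi-locality: for every cell `v` and radius `r` a LOCAL rule reading the sup-ball of
radius `2r` around `v` agrees with `T` on the sup-ball of radius `r` outside probability `≤ C e^{-c r}`.
A statement the route POSITS. [folklore] -/
def IsExchangeKernel (C c : ℝ) (S : Set ℤ) (i : ℤ) (T : Obs → Rnd → Obs) : Prop :=
  Measurable (Function.uncurry T) ∧
    ((νmix S).prod β).map (Function.uncurry T) = νmix (symmDiff S {i, i + 1}) ∧
    (∀ᵐ xu ∂((νmix S).prod β),
      (∀ v : Site 2, v 0 ≠ i + 1 → (v ∈ (T xu.1 xu.2).1 ↔ v ∈ xu.1.1)) ∧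
      (∀ f : Site 2, f 0 ≠ i → f 0 ≠ i + 1 → (f ∈ (T xu.1 xu.2).2 ↔ f ∈ xu.1.2)) ∧
      (∀ a b : Site 2, a 0 ≠ i + 1 → b 0 ≠ i + 1 →
        (b ∈ monoCluster (T xu.1 xu.2) a ↔ b ∈ monoCluster xu.1 a))) ∧
    (∀ (m : ℤ) (x : Obs) (u : Rnd), T (vshift m x) (ushift m u) = vshift m (T x u)) ∧
    (∀ (v : Site 2) (r : ℕ), ∃ Tloc : Obs → Rnd → Obs,
      (∀ (x x' : Obs) (u u' : Rnd),
        (∀ w ∈ ballInf v (2 * r), (w ∈ x.1 ↔ w ∈ x'.1) ∧ (w ∈ x.2 ↔ w ∈ x'.2) ∧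
          ∀ k : ℕ, ((w, k) ∈ u ↔ (w, k) ∈ u')) →
        ∀ w ∈ ballInf v r, (w ∈ (Tloc x u).1 ↔ w ∈ (Tloc x' u').1) ∧
          (w ∈ (Tloc x u).2 ↔ w ∈ (Tloc x' u').2)) ∧
      ((νmix S).prod β) {xu | ∃ w ∈ ballInf v r,
          ¬ ((w ∈ (T xu.1 xu.2).1 ↔ w ∈ (Tloc xu.1 xu.2).1) ∧
             (w ∈ (T xu.1 xu.2).2 ↔ w ∈ (Tloc xu.1 xu.2).2))} ≤
        ENNReal.ofReal (C * Real.exp (-c * r)))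

/-! ## §4 Stub statement 3 — conditional RSW, uniform in the column pattern -/

/-- Cells at sup-distance `≥ d` from the box `[a, a+w) × [b, b+h)`. [folklore] -/
def farFrom (a b : ℤ) (w h d : ℕ) : Set (Site 2) :=
  {v | v 0 < a - d ∨ a + w + d ≤ v 0 ∨ v 1 < b - d ∨ b + h + d ≤ v 1}

/-- Black left–right crossing of the box `[a, a+w) × [b, b+h)`. [folklore] -/
def lrCross (a b : ℤ) (w h : ℕ) : Set Obs :=
  {x | blackEdges x ∈ openCrossing {v | a ≤ v 0 ∧ v 0 < a + w ∧ b ≤ v 1 ∧ v 1 < b + h}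
    {v | v 0 = a ∧ b ≤ v 1 ∧ v 1 < b + h} {v | v 0 = a + w - 1 ∧ b ≤ v 1 ∧ v 1 < b + h}}

/-- Black bottom–top crossing of the box `[a, a+w) × [b, b+h)`. [folklore] -/
def tbCross (a b : ℤ) (w h : ℕ) : Set Obs :=
  {x | blackEdges x ∈ openCrossing {v | a ≤ v 0 ∧ v 0 < a + w ∧ b ≤ v 1 ∧ v 1 < b + h}
    {v | v 1 = b ∧ a ≤ v 0 ∧ v 0 < a + w} {v | v 1 = b + h - 1 ∧ a ≤ v 0 ∧ v 0 < a + w}}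

/-- CONDITIONAL RSW bound (arXiv:2502.08394 Thm 5.7 in its conditional form, for the column-mixed IK
family; registered stub `stub_ConditionalRSW : ∃ c, 0 < c ∧ ∀ S n, 1 ≤ n → ∀ a b E, MeasurableSet E →
CondRSWBound c S n a b E`): if `E` is determined by the cells at sup-distance `≥ n` from the `2n × n`
(resp. `n × 2n`) box at `(a, b)`, the box is crossed the long way by a black path with `ν_S`-probability
`≥ c` given `E`. A statement the route POSITS. [folklore] -/
def CondRSWBound (c : ℝ) (S : Set ℤ) (n : ℕ) (a b : ℤ) (E : Set Obs) : Prop :=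
  (E ∈ determinedOn (farFrom a b (2 * n) n n) →
    c * (νmix S).real E ≤ (νmix S).real (E ∩ lrCross a b (2 * n) n)) ∧
  (E ∈ determinedOn (farFrom a b n (2 * n) n) →
    c * (νmix S).real E ≤ (νmix S).real (E ∩ tbCross a b n (2 * n)))

/-! ## §5 Stub statement 4 — Manolescu's transport (§5.3 re-run) -/

/-- Monochromatic paths of colour `b` (`true` = black) in the observable configuration `x`. [folklore] -/
def monoPaths (x : Obs) (b : Bool) : Set (List (Site 2)) :=
  {p | p ≠ [] ∧ List.IsChain (cellGraph x.2).Adj p ∧ ∀ v ∈ p, (v ∈ x.1 ↔ b = true)}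

/-- Rescaled position of a cell. [folklore] -/
def pos (δ : ℝ) (v : Site 2) : ℂ := (δ : ℂ) * sqEmb v

/-- The paths `p'` that SHADOW the `K`-image of `p` within `ε` at mesh `δ`: Hausdorff distance `≤ ε`
between the point sets and `ε`-close first and last cells. [folklore] -/
def shadows (K : ℂ ≃L[ℝ] ℂ) (δ ε : ℝ) (p : List (Site 2)) : Set (List (Site 2)) :=
  {p' | (∀ v ∈ p, ∃ w ∈ p', ‖pos δ w - K (pos δ v)‖ ≤ ε) ∧ (∀ w ∈ p', ∃ v ∈ p, ‖pos δ w - K (pos δ v)‖ ≤ ε) ∧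
    (∀ v w, p.head? = some v → p'.head? = some w → ‖pos δ w - K (pos δ v)‖ ≤ ε) ∧
    (∀ v w, p.getLast? = some v → p'.getLast? = some w → ‖pos δ w - K (pos δ v)‖ ≤ ε)}

/-- The BAD event of a pair (IK bits, site-`𝕋` bits): some monochromatic path of diameter `≥ ε` inside
the window of radius `ρ` of one model has no shadow of the same colour in the other model. [folklore] -/
def badPair (K : ℂ ≃L[ℝ] ℂ) (δ ε ρ : ℝ) : Set (Ω × Ω) :=
  {ωω' | ∃ b : Bool,
    (∃ p ∈ monoPaths (obs Set.univ ωω'.1) b, (∀ v ∈ p, ‖pos δ v‖ ≤ ρ) ∧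
      (∃ v ∈ p, ∃ w ∈ p, ε ≤ ‖pos δ v - pos δ w‖) ∧
      ∀ p' ∈ monoPaths (obs ∅ ωω'.2) b, p' ∉ shadows K δ ε p) ∨
    (∃ p' ∈ monoPaths (obs ∅ ωω'.2) b, (∀ v ∈ p', ‖pos δ v‖ ≤ ρ) ∧
      (∃ v ∈ p', ∃ w ∈ p', ε ≤ ‖pos δ v - pos δ w‖) ∧
      ∀ p ∈ monoPaths (obs Set.univ ωω'.1) b, p ∉ shadows K.symm δ ε p')}

/-- TRANSPORT COUPLING through `K₁` (arXiv:2502.08394 Thm 5.4, "asymptotically similar up to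
`M_{β,α}`", in a path-wise form; registered stub `stub_LinearTransport : (∃ C c, … IsExchangeKernel …) →
(∃ c, … CondRSWBound …) → ∃ K₁, IsTransportCoupling K₁`): for every precision `ε` and window `ρ`, for
all small meshes, the isotropic IK model and the `S = ∅` model can be coupled so that, outside
probability `≤ ε`, every monochromatic path of diameter `≥ ε` in the window of either model is shadowed
within `ε` by a same-colour path of the other model after `K₁` (resp. `K₁⁻¹`). A statement the route
POSITS. [folklore] -/
def IsTransportCoupling (K₁ : ℂ ≃L[ℝ] ℂ) : Prop :=
  ∀ ε ρ : ℝ, 0 < ε → 0 < ρ → ∀ᶠ δ in 𝓝[>] (0 : ℝ),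
    ∃ γ : Measure (Ω × Ω), γ.map Prod.fst = μIK ∧ γ.map Prod.snd = μIK ∧
      γ (badPair K₁ δ ε ρ) ≤ ENNReal.ofReal ε

/-! ## §6 Stub statements 5 and 6 — from the coupling to the equivalence of crossing limits -/

/-- WITHIN-FAMILY TRANSPORT through `K₁` (registered stub `stub_CouplingToLimits : (∃ K₁,
IsTransportCoupling K₁) → (∃ K₀, IsTriShear K₀ ∧ CrudeCardyAlong K₀ ∅) → ∃ K₁, TransportsWithin K₁`):
limits of crude crossing probabilities of the isotropic model in `R` and of the `S = ∅` model in `K₁ R`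
coincide. A statement the route POSITS. [folklore] -/
def TransportsWithin (K₁ : ℂ ≃L[ℝ] ℂ) : Prop :=
  ∀ (R : ConformalRectangle) (L : ℝ),
    Tendsto (mixedCrossingProb Set.univ R) (𝓝[>] 0) (𝓝 L) ↔
      Tendsto (mixedCrossingProb ∅ (R.map K₁.toHomeomorph)) (𝓝[>] 0) (𝓝 L)

/-- `K₀` is the explicit shear `x + iy ↦ x + y ζ`, `ζ = e^{iπ/3}` (so `K₀ ∘ sqEmb = triEmbed`). [folklore] -/
def IsTriShear (K₀ : ℂ ≃L[ℝ] ℂ) : Prop := ∀ z : ℂ, K₀ z = (z.re : ℂ) + (z.im : ℂ) * triZeta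

/-- CRUDE CARDY ALONG `K₀` for the `S`-mixed model (registered stub `stub_CrudeCardyTri : ∃ K₀,
IsTriShear K₀ ∧ CrudeCardyAlong K₀ ∅` — the `S = ∅` member is site percolation on `δ𝕋` after the shear,
Smirnov's theorem `hasCrossingLimit_triDomainCrossingProb_holds` + crude-vs-canonical glue on `𝕋`):
the crude crossing probabilities of every conformal rectangle `R` converge to Cardy's value in the
modulus of `K₀ R`. A statement the route POSITS. [folklore] -/
def CrudeCardyAlong (K₀ : ℂ ≃L[ℝ] ℂ) (S : Set ℤ) : Prop :=
  ∀ R : ConformalRectangle,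
    ConformalRectangle.HasCrossingLimit (R.map K₀.toHomeomorph) (mixedCrossingProb S R)
      Literature.Probability.RandomPlanarGeometry.cardyFunction

/-! ## §7 The crux through the generic family, and the composition (sorry-free) -/

/-- The generic family at `S = univ` IS the crux's `P_IK` (`Negative.Pik`, the verbatim copy; the two
spellings differ only by the decidability instance of `· ∈ univ` inside `Finset.filter`). [folklore] -/
theorem mixedCrossingProb_univ (R : ConformalRectangle) : mixedCrossingProb Set.univ R = Negative.Pik R := by
  funext δ
  unfold mixedCrossingProb sqEmb
  simp only [Negative.Pik, μIK, obs, blackEdges, blackSet, antiSet, parSet, Set.mem_setOf_eq]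

/-- The crux, read through the generic `S`-mixed family at `S = univ`: it is Cardy's formula for
`mixedCrossingProb univ` on `K`-images (`Negative.crux_iff_cardyOnImages`). [folklore] -/
theorem crux_iff :
    Summit.CriticalPhenomena.CardyFormulaZ2.Theses.CardyIKTransport.IKLinearTransport ↔
      ∃ K : ℂ ≃L[ℝ] ℂ, Negative.CardyOnImages (mixedCrossingProb Set.univ) K := by
  rw [Negative.crux_iff_cardyOnImages, show mixedCrossingProb Set.univ = Negative.Pik from
    funext mixedCrossingProb_univ]

/-- THE COMPOSITION (kernel-checked, no `sorry`; registered on the crux item under this name so that this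
vocabulary file lands as a `--supports` file): the six registered stub signatures of the line
`pinned-diagram-exchange` imply the crux (a CONDITIONAL theorem — it credits nothing by itself; the lead's
skeleton instantiates it with the six `stub_*`). `K := K₁.trans K₀`;
`(R.map K₁).map K₀ = R.map K` (`Negative.markedDomain_map_map`); `CrudeCardyAlong K₀ ∅` gives the
`S = ∅` family the limit `F(η(K R))`, `TransportsWithin K₁` transfers it to `S = univ`, and `crux_iff`
(Smirnov's theorem inside) concludes. [folklore] -/
theorem IKLinearTransport_of_stubs :
    (∀ (L : ℕ) [NeZero L], 3 ≤ L → DiagramExchangeAt L) →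
    ((∀ (L : ℕ) [NeZero L], 3 ≤ L → DiagramExchangeAt L) →
      ∃ C c : ℝ, 0 < c ∧ ∀ (S : Set ℤ) (i : ℤ), (i ∈ S ↔ i + 1 ∉ S) →
        ∃ T : Obs → Rnd → Obs, IsExchangeKernel C c S i T) →
    (∃ c : ℝ, 0 < c ∧ ∀ (S : Set ℤ) (n : ℕ), 1 ≤ n → ∀ (a b : ℤ) (E : Set Obs), MeasurableSet E →
      CondRSWBound c S n a b E) →
    ((∃ C c : ℝ, 0 < c ∧ ∀ (S : Set ℤ) (i : ℤ), (i ∈ S ↔ i + 1 ∉ S) →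
        ∃ T : Obs → Rnd → Obs, IsExchangeKernel C c S i T) →
      (∃ c : ℝ, 0 < c ∧ ∀ (S : Set ℤ) (n : ℕ), 1 ≤ n → ∀ (a b : ℤ) (E : Set Obs), MeasurableSet E →
        CondRSWBound c S n a b E) →
      ∃ K₁ : ℂ ≃L[ℝ] ℂ, IsTransportCoupling K₁) →
    ((∃ K₁ : ℂ ≃L[ℝ] ℂ, IsTransportCoupling K₁) → (∃ K₀ : ℂ ≃L[ℝ] ℂ, IsTriShear K₀ ∧ CrudeCardyAlong K₀ ∅) →
      ∃ K₁ : ℂ ≃L[ℝ] ℂ, TransportsWithin K₁) →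
    (∃ K₀ : ℂ ≃L[ℝ] ℂ, IsTriShear K₀ ∧ CrudeCardyAlong K₀ ∅) →
      Summit.CriticalPhenomena.CardyFormulaZ2.Theses.CardyIKTransport.IKLinearTransport := by
  intro hDiag hPinned hRSW hLin hC2L hCardy
  obtain ⟨K₁, hK₁⟩ := hC2L (hLin (hPinned hDiag) hRSW) hCardy
  obtain ⟨K₀, -, hK₀⟩ := hCardy
  rw [crux_iff]
  refine ⟨K₁.trans K₀, fun R φ x hφx => ?_⟩
  have htrans : (K₁.trans K₀).toHomeomorph = K₁.toHomeomorph.trans K₀.toHomeomorph :=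
    Homeomorph.ext fun _ => rfl
  have hmap : R.map (K₁.trans K₀).toHomeomorph = (R.map K₁.toHomeomorph).map K₀.toHomeomorph := by
    rw [htrans, Negative.markedDomain_map_map]
  have hIK' := hK₀ (R.map K₁.toHomeomorph)
  rw [← hmap] at hIK'
  exact (hK₁ R _).2 (hIK' φ x hφx)

end Summit.CriticalPhenomena.CardyFormulaZ2.Theorems.IKLinearTransport.PinnedDiagramExchange
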